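import Summits.CriticalPhenomena.PercolationContinuityZ3.Theorems.PercNearOneGluingNoHeavyLowerTailAntitheticCycleStair
import Summits.CriticalPhenomena.PercolationContinuityZ3.Theorems.PercNearOneGluingNoHeavyLowerTailAntitheticCycleReflect
import HarnessLib

/-!
# `NoHeavyLowerTail` (stmt-CriticalPhenomena-4575) — antithetic cluster pairs: first runs of the two legs of a cycle at a position `a` and the
# TOP colourings of the staircase pieces (THEOREM C, file C2b; prim-hp-2 gen 39, HOME/THEOREM-C-cycles.md "LEAN BLUEPRINT")

Support file (`--supports stmt-CriticalPhenomena-4575`, hull-port prover `prim-hp-2`, gen 39).  No named facts, no sorries; standard axioms.  The `def`s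
`Antithetic.Cyc.{fru, frw, topU}` are proof-internal bookkeeping.

For a colouring `ω` of the cycle and a position `0 < a < n`: `fru ω = min a (pre ω + pre ωᶜ)` is the first run of the leg `u = (edge 0, …, edge (a−1))`
(exactly one of `pre ω`, `pre ωᶜ` is positive), `frw ω = min (n−a) (suf ω + suf ωᶜ)` that of `w = (edge (n−1), …, edge a)`.
* `Cyc.fru_spec` — with `k = fru ω`: `1 ≤ k ≤ a`, the pairs `edge i`, `i < k`, have the colour of `edge 0`, and if `k < a` the pair `edge k` has the
  other colour; `Cyc.fru_eq_of` — conversely these facts determine `fru`; `Cyc.frw_eq_fru_reflect` — `frw` is `fru` of the reflected cycle.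
* `Cyc.topU` — the top colouring of the staircase piece with cube leg `u` (run `k`, partner `w` red): `Cyc.topU_spec` (the four hypotheses of
  …CycleStair), `Cyc.topU_resp` — for `ω` changing colour at `a` with `fru ω = k < a` and (`k ≤ frw ω` or `w` pure), `topU ∆ ω` respects the labels
  `Cyc.lab n a k (min k (n−a+1))`, i.e. `ω` lies in the staircase piece topped by `topU`.
[cite: VandenbergHaggstromKahn2005, §1 p. 3 (open cluster `C_s`)]
-/

noncomputable section

namespace Summit.CriticalPhenomena.PercolationContinuityZ3.Theorems

open Literature.Probability.Percolation
open scoped Classical symmDiff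

namespace Antithetic

namespace Cyc

variable {V : Type*} (n : ℕ) (v : ℕ → V) (a : ℕ)

/-- First run of the leg `u = (edge 0, …, edge (a−1))` (number of initial pairs with the colour of `edge 0`, capped at `a`). [this work] -/
def fru (ω : Set (Sym2 V)) : ℕ := min a (pre n v ω + pre n v ωᶜ)

/-- First run of the leg `w = (edge (n−1), …, edge a)`. [this work] -/
def frw (ω : Set (Sym2 V)) : ℕ := min (n - a) (suf n v ω + suf n v ωᶜ)

/-- The top colouring of the staircase piece with cube leg `u`, run `k`, partner `w`: `edge i` red for `i < k` and for `a ≤ i < n`, blue for `i = k` and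
`i = a − 1`, unchanged elsewhere. [this work] -/
def topU (k : ℕ) (ω : Set (Sym2 V)) : Set (Sym2 V) :=
  {e | (e ∈ ω ∧ ¬ ∃ i, i < n ∧ (i ≤ k ∨ i = a - 1 ∨ a ≤ i) ∧ e = edge v i) ∨ ∃ i, i < n ∧ (i < k ∨ a ≤ i) ∧ e = edge v i}

variable {n v a} (hn : 3 ≤ n) (hinj : ∀ i j, i < n → j < n → v i = v j → i = j) (hper : v n = v 0) (ha0 : 0 < a) (han : a < n)

section Runs

variable (ω : Set (Sym2 V))

include ha0 han in
/-- **Structure of the first run of `u`.** [this work] -/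
theorem fru_spec : 1 ≤ fru n v a ω ∧ fru n v a ω ≤ a ∧ (∀ i, i < fru n v a ω → (edge v i ∈ ω ↔ edge v 0 ∈ ω)) ∧
    (fru n v a ω < a → ¬ (edge v (fru n v a ω) ∈ ω ↔ edge v 0 ∈ ω)) := by
  unfold fru
  by_cases h0 : edge v 0 ∈ ω
  · have hpc : pre n v ωᶜ = 0 := by
      by_contra hne
      exact (red_of_lt_pre ωᶜ (Nat.pos_of_ne_zero hne)) h0
    have hp1 : 1 ≤ pre n v ω := le_pre ω (by omega) fun i hi => by rw [show i = 0 by omega]; exact h0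
    rw [hpc, Nat.add_zero]
    refine ⟨by omega, Nat.min_le_left _ _, fun i hi => iff_of_true (red_of_lt_pre ω (lt_of_lt_of_le hi (Nat.min_le_right _ _))) h0, fun hlt => ?_⟩
    have hpa : min a (pre n v ω) = pre n v ω := Nat.min_eq_right (by omega)
    rw [hpa] at hlt ⊢
    exact fun h => not_red_pre (n := n) (v := v) ω (by omega) (h.2 h0)
  · have hp : pre n v ω = 0 := by
      by_contra hne
      exact h0 (red_of_lt_pre ω (Nat.pos_of_ne_zero hne))
    have hp1 : 1 ≤ pre n v ωᶜ := le_pre ωᶜ (by omega) fun i hi => by rw [show i = 0 by omega]; exact h0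
    rw [hp, Nat.zero_add]
    refine ⟨by omega, Nat.min_le_left _ _, fun i hi => iff_of_false (red_of_lt_pre ωᶜ (lt_of_lt_of_le hi (Nat.min_le_right _ _))) h0,
      fun hlt => ?_⟩
    have hpa : min a (pre n v ωᶜ) = pre n v ωᶜ := Nat.min_eq_right (by omega)
    rw [hpa] at hlt ⊢
    intro h
    have := not_red_pre (n := n) (v := v) ωᶜ (by omega)
    rw [Set.mem_compl_iff, not_not] at this
    exact h0 (h.1 this)

include ha0 han in
/-- **`fru` is determined by the run structure**: if the first `k` pairs (`1 ≤ k ≤ a`) have the colour of `edge 0` and (when `k < a`) `edge k` has the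
other colour, then `fru ω = k`. [this work] -/
theorem fru_eq_of {k : ℕ} (_hk1 : 1 ≤ k) (hka : k ≤ a) (hrun : ∀ i, i < k → (edge v i ∈ ω ↔ edge v 0 ∈ ω))
    (hstop : k < a → ¬ (edge v k ∈ ω ↔ edge v 0 ∈ ω)) : fru n v a ω = k := by
  obtain ⟨h1, hle, hrun', hstop'⟩ := fru_spec ha0 han ω
  by_contra hne
  rcases Nat.lt_or_gt_of_ne hne with hlt | hgt
  · exact hstop' (by omega) (hrun _ hlt)
  · exact hstop (by omega) (hrun' _ hgt)

/-- `frw` is `fru` of the reflected cycle at the reflected position `n − a`. [this work] -/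
theorem frw_eq_fru_reflect : frw n v a ω = fru n (fun i => v (n - i)) (n - a) ω := by
  unfold frw fru
  rw [pre_reflect ω, pre_reflect ωᶜ]

end Runs

section Top

variable (k : ℕ) (hk1 : 1 ≤ k) (hka : k < a) (ω : Set (Sym2 V))

include hn hinj hper hk1 hka han in
/-- The top colouring has the four properties required by …CycleStair. [this work] -/
theorem topU_spec : (∀ i, i < k → edge v i ∈ topU n v a k ω) ∧ edge v k ∉ topU n v a k ω ∧
    (∀ i, a ≤ i → i < n → edge v i ∈ topU n v a k ω) ∧ edge v (a - 1) ∉ topU n v a k ω := by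
  refine ⟨fun i hi => Or.inr ⟨i, by omega, Or.inl hi, rfl⟩, ?_, fun i hai hin => Or.inr ⟨i, hin, Or.inr hai, rfl⟩, ?_⟩
  · rintro (⟨-, h⟩ | ⟨i, hi, hik, he⟩)
    · exact h ⟨k, by omega, Or.inl le_rfl, rfl⟩
    · have := edge_inj hn hinj hper (by omega) hi he; omega
  · rintro (⟨-, h⟩ | ⟨i, hi, hik, he⟩)
    · exact h ⟨a - 1, by omega, Or.inr (Or.inl rfl), rfl⟩
    · have := edge_inj hn hinj hper (by omega) hi he; omega

include hn hinj hper hka in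
/-- Outside the prescribed pairs the top colouring agrees with `ω`. -/
theorem topU_free {i : ℕ} (hi : i < n) (h1 : k < i) (h2 : i ≠ a - 1) (h3 : i < a) : edge v i ∈ topU n v a k ω ↔ edge v i ∈ ω := by
  constructor
  · rintro (⟨h, -⟩ | ⟨j, hj, hjk, he⟩)
    · exact h
    · have := edge_inj hn hinj hper hi hj he; omega
  · intro h
    refine Or.inl ⟨h, ?_⟩
    rintro ⟨j, hj, hjk, he⟩
    have := edge_inj hn hinj hper hi hj he; omega

include hn hinj hper ha0 han hk1 hka in
/-- **`ω` lies in the staircase piece topped by `topU`**: for `ω` changing colour at `a`, with `fru ω = k < a` and `k ≤ frw ω ∨ frw ω = n − a`, the flip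
set `topU ∆ ω` respects the labels `lab n a k (min k (n − a + 1))`. [this work] -/
theorem topU_resp (hchg : ¬ (edge v (a - 1) ∈ ω ↔ edge v a ∈ ω)) (hfru : fru n v a ω = k)
    (hw : k ≤ frw n v a ω ∨ frw n v a ω = n - a) :
    ∀ i j, i < n → j < n → lab n a k (min k (n - a + 1)) i = lab n a k (min k (n - a + 1)) j →
      (edge v i ∈ topU n v a k ω ∆ ω ↔ edge v j ∈ topU n v a k ω ∆ ω) := by
  obtain ⟨hT0, hTk, hTw, hTa⟩ := topU_spec hn hinj hper han k hk1 hka ω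
  obtain ⟨-, -, hrun, hstop⟩ := fru_spec ha0 han ω
  rw [hfru] at hrun hstop
  have hstop' := hstop hka
  -- the colour `d₀` of the partner letters touched by the piece: indices `i ≥ max a (n-k)` have the colour of `edge (n-1)`
  have hwrun : ∀ i, a ≤ i → n - min k (n - a + 1) ≤ i → i < n → (edge v i ∈ ω ↔ edge v (n - 1) ∈ ω) := by
    intro i hai him hin
    obtain ⟨-, -, hrunR, -⟩ := fru_spec (n := n) (v := fun i => v (n - i)) (a := n - a) (by omega) (by omega) ω
    rw [← frw_eq_fru_reflect] at hrunR
    have key : ∀ j, j < frw n v a ω → (edge v (n - 1 - j) ∈ ω ↔ edge v (n - 1) ∈ ω) := fun j hj => by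
      have := hrunR j hj
      rwa [edge_reflect (by have := Nat.min_le_left (n - a) (suf n v ω + suf n v ωᶜ); unfold frw at hj; omega), edge_reflect (by omega),
        Nat.sub_zero] at this
    have := key (n - 1 - i) (by rcases hw with hw | hw <;> omega)
    rwa [show n - 1 - (n - 1 - i) = i by omega] at this
  -- class conditions of the label function (m = min k (n-a+1))
  set m := min k (n - a + 1) with hm
  have fm : ∀ {e : Sym2 V}, e ∈ topU n v a k ω → (e ∈ topU n v a k ω ∆ ω ↔ e ∉ ω) := fun he => by
    rw [Set.mem_symmDiff]; exact ⟨fun h => h.elim (fun h => h.2) fun h => absurd he h.2, fun h => Or.inl ⟨he, h⟩⟩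
  have fn : ∀ {e : Sym2 V}, e ∉ topU n v a k ω → (e ∈ topU n v a k ω ∆ ω ↔ e ∈ ω) := fun he => by
    rw [Set.mem_symmDiff]; exact ⟨fun h => h.elim (fun h => absurd h.1 he) fun h => h.1, fun h => Or.inr ⟨h, he⟩⟩
  have hc0 : edge v (a - 1) ∈ ω ↔ edge v a ∉ ω := by
    constructor
    · exact fun h1 h2 => hchg (iff_of_true h1 h2)
    · intro h2; by_contra h1; exact hchg (iff_of_false h1 h2)
  have hP0 : ∀ i, i < n → (i = a - 1 ∨ i = a ∨ (k + 1 = a ∧ i ≤ k) ∨ (n - m ≤ a ∧ a ≤ i)) →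
      (edge v i ∈ topU n v a k ω ∆ ω ↔ edge v a ∉ ω) := by
    intro i hi hc
    rcases hc with h | h | ⟨hk, hik⟩ | ⟨hmle, hai⟩
    · rw [h, fn hTa]; exact hc0
    · rw [h, fm (hTw a le_rfl han)]
    · -- merged run block: a - 1 = k
      have hak : a - 1 = k := by omega
      by_cases hik' : i < k
      · rw [fm (hT0 i hik'), (hrun i hik').not, ← hc0, hak]
        -- edge k ∈ ω ↔ ¬ edge 0 ∈ ω
        constructor
        · intro h0; by_contra hk'; exact hstop' (iff_of_false hk' h0)
        · intro hk' h0; exact hstop' (iff_of_true hk' h0)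
      · have hieq : i = k := by omega
        rw [hieq, fn hTk, ← hc0, hak]
    · rw [fm (hTw i hai hi), (hwrun i hai (by omega) hi).not, (hwrun a le_rfl (by omega) han).not]
  have hP1 : ∀ i, i < n → i ≤ k → (edge v i ∈ topU n v a k ω ∆ ω ↔ edge v 0 ∉ ω) := by
    intro i hi hik
    by_cases hik' : i < k
    · rw [fm (hT0 i hik'), (hrun i hik').not]
    · have hieq : i = k := by omega
      rw [hieq, fn hTk]
      constructor
      · intro hk' h0; exact hstop' (iff_of_true hk' h0)
      · intro h0; by_contra hk'; exact hstop' (iff_of_false hk' h0)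
  have hP2 : ∀ i, i < n → a ≤ i → n - m ≤ i → (edge v i ∈ topU n v a k ω ∆ ω ↔ edge v (n - 1) ∉ ω) := by
    intro i hi hai him
    rw [fm (hTw i hai hi), (hwrun i hai him hi).not]
  -- label inversion
  have hlab : ∀ i, i < n →
      (lab n a k m i = 0 ∧ (i = a - 1 ∨ i = a ∨ (k + 1 = a ∧ i ≤ k) ∨ (n - m ≤ a ∧ a ≤ i))) ∨
      (lab n a k m i = 1 ∧ i ≤ k) ∨ (lab n a k m i = 2 ∧ a ≤ i ∧ n - m ≤ i) ∨
      (lab n a k m i = i + 3) := by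
    intro i hi
    unfold lab
    by_cases c0 : i = a - 1 ∨ i = a ∨ (k + 1 = a ∧ i ≤ k) ∨ (n - m ≤ a ∧ a ≤ i)
    · exact Or.inl ⟨by rw [if_pos c0], c0⟩
    · rw [if_neg c0]
      by_cases c1 : i ≤ k
      · exact Or.inr (Or.inl ⟨by rw [if_pos c1], c1⟩)
      · rw [if_neg c1]
        by_cases c2 : n - m ≤ i
        · refine Or.inr (Or.inr (Or.inl ⟨by rw [if_pos c2], ?_, c2⟩))
          -- not in the tie class, beyond k and ≥ n - m ≥ a - 1: so i ≥ a
          by_contra hlt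
          push Not at c0
          omega
        · exact Or.inr (Or.inr (Or.inr (by rw [if_neg c2])))
  intro i j hi hj hl
  rcases hlab i hi with ⟨li, ci⟩ | ⟨li, ci⟩ | ⟨li, ci, ci'⟩ | li <;>
    rcases hlab j hj with ⟨lj, cj⟩ | ⟨lj, cj⟩ | ⟨lj, cj, cj'⟩ | lj
  all_goals first
    | (rw [hP0 i hi ci, hP0 j hj cj])
    | (rw [hP1 i hi ci, hP1 j hj cj])
    | (rw [hP2 i hi ci ci', hP2 j hj cj cj'])
    | (exfalso; omega)
    | (have hij : i = j := by omega
       subst hij; rfl)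

include hn hinj hper ha0 han hk1 hka in
/-- **`ω` lies in the staircase piece topped by `topU`, general partner tie length** `m ≤ n − a + 1` with `m ≤ frw ω` or `frw ω = n − a` (needed for the
reflected orientation, where the partner's first `k+1` letters are tied): `topU ∆ ω` respects the labels `lab n a k m`. [this work] -/
theorem topU_resp_gen (hchg : ¬ (edge v (a - 1) ∈ ω ↔ edge v a ∈ ω)) (hfru : fru n v a ω = k) {m : ℕ} (hmq : m ≤ n - a + 1)
    (hw : m ≤ frw n v a ω ∨ frw n v a ω = n - a) :
    ∀ i j, i < n → j < n → lab n a k m i = lab n a k m j → (edge v i ∈ topU n v a k ω ∆ ω ↔ edge v j ∈ topU n v a k ω ∆ ω) := by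
  obtain ⟨hT0, hTk, hTw, hTa⟩ := topU_spec hn hinj hper han k hk1 hka ω
  obtain ⟨-, -, hrun, hstop⟩ := fru_spec ha0 han ω
  rw [hfru] at hrun hstop
  have hstop' := hstop hka
  -- the colour `d₀` of the partner letters touched by the piece: indices `i ≥ max a (n-k)` have the colour of `edge (n-1)`
  have hwrun : ∀ i, a ≤ i → n - m ≤ i → i < n → (edge v i ∈ ω ↔ edge v (n - 1) ∈ ω) := by
    intro i hai him hin
    obtain ⟨-, -, hrunR, -⟩ := fru_spec (n := n) (v := fun i => v (n - i)) (a := n - a) (by omega) (by omega) ω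
    rw [← frw_eq_fru_reflect] at hrunR
    have key : ∀ j, j < frw n v a ω → (edge v (n - 1 - j) ∈ ω ↔ edge v (n - 1) ∈ ω) := fun j hj => by
      have := hrunR j hj
      rwa [edge_reflect (by have := Nat.min_le_left (n - a) (suf n v ω + suf n v ωᶜ); unfold frw at hj; omega), edge_reflect (by omega),
        Nat.sub_zero] at this
    have := key (n - 1 - i) (by rcases hw with hw | hw <;> omega)
    rwa [show n - 1 - (n - 1 - i) = i by omega] at this
  -- class conditions of the label function
  have fm : ∀ {e : Sym2 V}, e ∈ topU n v a k ω → (e ∈ topU n v a k ω ∆ ω ↔ e ∉ ω) := fun he => by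
    rw [Set.mem_symmDiff]; exact ⟨fun h => h.elim (fun h => h.2) fun h => absurd he h.2, fun h => Or.inl ⟨he, h⟩⟩
  have fn : ∀ {e : Sym2 V}, e ∉ topU n v a k ω → (e ∈ topU n v a k ω ∆ ω ↔ e ∈ ω) := fun he => by
    rw [Set.mem_symmDiff]; exact ⟨fun h => h.elim (fun h => absurd h.1 he) fun h => h.1, fun h => Or.inr ⟨h, he⟩⟩
  have hc0 : edge v (a - 1) ∈ ω ↔ edge v a ∉ ω := by
    constructor
    · exact fun h1 h2 => hchg (iff_of_true h1 h2)
    · intro h2; by_contra h1; exact hchg (iff_of_false h1 h2)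
  have hP0 : ∀ i, i < n → (i = a - 1 ∨ i = a ∨ (k + 1 = a ∧ i ≤ k) ∨ (n - m ≤ a ∧ a ≤ i)) →
      (edge v i ∈ topU n v a k ω ∆ ω ↔ edge v a ∉ ω) := by
    intro i hi hc
    rcases hc with h | h | ⟨hk, hik⟩ | ⟨hmle, hai⟩
    · rw [h, fn hTa]; exact hc0
    · rw [h, fm (hTw a le_rfl han)]
    · -- merged run block: a - 1 = k
      have hak : a - 1 = k := by omega
      by_cases hik' : i < k
      · rw [fm (hT0 i hik'), (hrun i hik').not, ← hc0, hak]
        -- edge k ∈ ω ↔ ¬ edge 0 ∈ ω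
        constructor
        · intro h0; by_contra hk'; exact hstop' (iff_of_false hk' h0)
        · intro hk' h0; exact hstop' (iff_of_true hk' h0)
      · have hieq : i = k := by omega
        rw [hieq, fn hTk, ← hc0, hak]
    · rw [fm (hTw i hai hi), (hwrun i hai (by omega) hi).not, (hwrun a le_rfl (by omega) han).not]
  have hP1 : ∀ i, i < n → i ≤ k → (edge v i ∈ topU n v a k ω ∆ ω ↔ edge v 0 ∉ ω) := by
    intro i hi hik
    by_cases hik' : i < k
    · rw [fm (hT0 i hik'), (hrun i hik').not]
    · have hieq : i = k := by omega
      rw [hieq, fn hTk]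
      constructor
      · intro hk' h0; exact hstop' (iff_of_true hk' h0)
      · intro h0; by_contra hk'; exact hstop' (iff_of_false hk' h0)
  have hP2 : ∀ i, i < n → a ≤ i → n - m ≤ i → (edge v i ∈ topU n v a k ω ∆ ω ↔ edge v (n - 1) ∉ ω) := by
    intro i hi hai him
    rw [fm (hTw i hai hi), (hwrun i hai him hi).not]
  -- label inversion
  have hlab : ∀ i, i < n →
      (lab n a k m i = 0 ∧ (i = a - 1 ∨ i = a ∨ (k + 1 = a ∧ i ≤ k) ∨ (n - m ≤ a ∧ a ≤ i))) ∨
      (lab n a k m i = 1 ∧ i ≤ k) ∨ (lab n a k m i = 2 ∧ a ≤ i ∧ n - m ≤ i) ∨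
      (lab n a k m i = i + 3) := by
    intro i hi
    unfold lab
    by_cases c0 : i = a - 1 ∨ i = a ∨ (k + 1 = a ∧ i ≤ k) ∨ (n - m ≤ a ∧ a ≤ i)
    · exact Or.inl ⟨by rw [if_pos c0], c0⟩
    · rw [if_neg c0]
      by_cases c1 : i ≤ k
      · exact Or.inr (Or.inl ⟨by rw [if_pos c1], c1⟩)
      · rw [if_neg c1]
        by_cases c2 : n - m ≤ i
        · refine Or.inr (Or.inr (Or.inl ⟨by rw [if_pos c2], ?_, c2⟩))
          -- not in the tie class, beyond k and ≥ n - m ≥ a - 1: so i ≥ a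
          by_contra hlt
          push Not at c0
          omega
        · exact Or.inr (Or.inr (Or.inr (by rw [if_neg c2])))
  intro i j hi hj hl
  rcases hlab i hi with ⟨li, ci⟩ | ⟨li, ci⟩ | ⟨li, ci, ci'⟩ | li <;>
    rcases hlab j hj with ⟨lj, cj⟩ | ⟨lj, cj⟩ | ⟨lj, cj, cj'⟩ | lj
  all_goals first
    | (rw [hP0 i hi ci, hP0 j hj cj])
    | (rw [hP1 i hi ci, hP1 j hj cj])
    | (rw [hP2 i hi ci ci', hP2 j hj cj cj'])
    | (exfalso; omega)
    | (have hij : i = j := by omega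
       subst hij; rfl)

end Top

end Cyc

end Antithetic

end Summit.CriticalPhenomena.PercolationContinuityZ3.Theorems
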